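import Summits.HodgeConjecture.HodgeConjecture.Theorems.MarkmanPartnerTransportLowPicardRMOrphanCell

/-!
# Route MarkmanPartnerTransport · crux #5 `LowPicardRealMultiplication` (stmt-HodgeConjecture-19653) —
# «KAPPA TABLE BY NAME»: on every cell `(ρ, d)`, HC⁴ ⟺ the `d − 1` kappa classes `κ_θ, …, κ_{θ^{d−1}}` are algebraic

Cell hodge-nonav, chapter ROUTE-P1AL; planner p1 g40 ASSIGN (K) «KAPPA TABLE BY NAME» (2026-08-28T18:31Z); prover seat
hodge-nonav-20241-p1 (gen 16). Route-independent (no Theses import; notations of `…LowPicardRMCellsKappa` copied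
verbatim); `--supports stmt-HodgeConjecture-19653` helper. The by-name, per-cell form of «KAPPA-IFF-SHARP»
(`hodgeConjectureFor_iff_kappaClass_pow_lt_mem_algebraicClasses`, `…LowPicardRMOrphanCell`):

* `CellKappaPowLt[ρ, d]` — on the cell `(ρ, d)`, for every `θ` carrying the `RMgen` data, the `d − 1` classes
  `κ_{θᵏ}` (`1 ≤ k < d`) are algebraic;
* `cellKappaPowLt_of_cellHC` (fact-free), `cellHC_of_cellKappaPowLt`, **`cellHC_iff_cellKappaPowLt (ρ d)`** —
  `CellHC[ρ, d] ↔ CellKappaPowLt[ρ, d]` for EVERY `(ρ, d)`, modulo {Verbitsky–Guan, O'Grady 2008} ONLY (no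
  Charles–Markman, no partner, no Markman, no Beauville);
* the six cells of the crux by name: `cellHC_iff_cellKappaPowLt_12` (one class `κ_θ`), `_23` (`κ_θ, κ_{θ²}`), `_27`
  (six classes), `_32` (one class), `_34` (three classes), `_35` (four classes).

So the `X`-side table of crux #5 reads uniformly «HC⁴ on the cell `(ρ, d)` ⟺ the `d − 1` explicit rational
`(2,2)`-classes `κ_{θᵏ} = Σᵢⱼ (G⁻¹)ᵢⱼ φ⁻¹eᵢ ∪ θᵏ(φ⁻¹eⱼ)` of the RM generator are algebraic on every member»; nothing here
constructs any of them. CONDITIONAL on the displayed named facts; no definition, no sorry, no new named fact; credits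
nothing to HC.

References: K. O'Grady, Commun. Contemp. Math. 10 (2008) §2.2, §3; S. Novario, Kyoto J. Math. 66 (2026) Thm. 6.2;
Yu. G. Zarhin, J. reine angew. Math. 341 (1983) Thm. 1.5.1; E. Markman, JEMS (2024) §1.1.
-/

noncomputable section

set_option linter.dupNamespace false

open scoped Matrix
open Module CategoryTheory
open Literature.AlgebraicTopology.SingularHomology Literature.Geometry.Kaehler
open Literature.AlgebraicGeometry Literature.AlgebraicGeometry.Motives Literature.AlgebraicGeometry.HodgeTheory
open Literature.AlgebraicGeometry.Hyperkaehler Literature.AlgebraicGeometry.Surfaces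
open Summit.HodgeConjecture.HodgeConjecture.Theorems.NikulinTwinTransport
open Summit.HodgeConjecture.HodgeConjecture.Theorems.MarkmanPartnerTransport.BBFPositivity

namespace Summit.HodgeConjecture.HodgeConjecture.Theorems.MarkmanPartnerTransport.PartnerLattice

/-- `MarkedK3Sq[X, φ, P, z]`: VERBATIM the `let MarkedK3Sq := …` binder of the route declarations of
MarkmanPartnerTransport (clauses (m1)–(m6)). Local notation only. -/
local notation3 (prettyPrint := false) "MarkedK3Sq[" X ", " φ ", " P ", " z "]" =>
  (((IsIntegralClass P ∧ ∀ Q : complexBetti X (2 * 4), IsIntegralClass Q → ∃ n : ℤ, Q = n • P) ∧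
    (∀ c : complexBetti X 2, IsIntegralClass c ↔ ∃ v : K3HilbertIndex → ℤ, φ c = fun i => (v i : ℂ)) ∧
    (∀ a : complexBetti X 2, cupPowTwo a 4 = ((3 : ℂ) * (k3HilbertForm 2 (φ a) (φ a)) ^ 2) • P) ∧
    (IsOfHodgeType 4 X 2 2 0 (LinearEquiv.symm φ z) ∧
      ∀ τ : complexBetti X 2, IsOfHodgeType 4 X 2 2 0 τ → ∃ t : ℂ, τ = t • LinearEquiv.symm φ z) ∧
    (∀ c : complexBetti X 2, IsOfHodgeType 4 X 2 1 1 c ↔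
      (k3HilbertForm 2 (φ c) z = 0 ∧ k3HilbertForm 2 (φ c) (star z) = 0)) ∧
    (k3HilbertForm 2 z z = 0 ∧ 0 < (k3HilbertForm 2 (star z) z).re)))

/-- `SpIso[X, φ]`: VERBATIM the `let SpannedByIsometries := …` binder of the route declarations (with
`IsBBFTransc` unfolded). Local notation only. -/
local notation3 (prettyPrint := false) "SpIso[" X ", " φ "]" =>
  (∀ f : complexBetti X 2 →ₗ[ℂ] complexBetti X 2, (∀ y, IsRationalClass y → IsRationalClass (f y)) →
    (∀ (i j : ℕ) y, IsOfHodgeType 4 X 2 i j y → IsOfHodgeType 4 X 2 i j (f y)) →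
    (∀ d : complexBetti X 2, d ∈ algebraicClasses X 1 → f d = 0) →
    (∀ y : complexBetti X 2, ∀ d : complexBetti X 2, d ∈ algebraicClasses X 1 →
      k3HilbertForm 2 (φ (f y)) (φ d) = 0) →
    ∃ (k : ℕ) (c : Fin k → ℚ) (g : Fin k → (complexBetti X 2 →ₗ[ℂ] complexBetti X 2)),
      (∀ i, Function.Bijective (g i) ∧ (∀ y, IsRationalClass y → IsRationalClass (g i y)) ∧
        (∀ (a b : ℕ) y, IsOfHodgeType 4 X 2 a b y → IsOfHodgeType 4 X 2 a b (g i y)) ∧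
        (∀ a b, k3HilbertForm 2 (φ (g i a)) (φ (g i b)) = k3HilbertForm 2 (φ a) (φ b))) ∧
      ∀ y : complexBetti X 2, (∀ d : complexBetti X 2, d ∈ algebraicClasses X 1 →
        k3HilbertForm 2 (φ y) (φ d) = 0) → f y = ∑ i : Fin k, ((c i : ℂ) • g i y))

/-- `RMgen[X, φ, z, d]` («RMgen» data, the `RMGenData` of Sketch P1AK-CELLS with self-adjointness added): a
rational, type-preserving, `q`-self-adjoint endomorphism `θ` of `H²(X(ℂ); ℂ)` with `θ σ = ev · σ`, `ev` real,
`deg minpoly_ℚ(ev) = d`, `d · n + ρ(X) = 23` for some `n ≥ 3`, and GEN: every rational type-preserving endomorphism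
is `Σ_{i<d} cᵢ θⁱ` (`cᵢ ∈ ℚ`) on `T(X)_ℂ = {y : q(φ y, φ N¹(X)) = 0}`. Local notation only. -/
local notation3 (prettyPrint := false) "RMgen[" X ", " φ ", " z ", " d "]" =>
  (∃ θ : complexBetti X 2 →ₗ[ℂ] complexBetti X 2, (∀ y, IsRationalClass y → IsRationalClass (θ y)) ∧
    (∀ (i j : ℕ) y, IsOfHodgeType 4 X 2 i j y → IsOfHodgeType 4 X 2 i j (θ y)) ∧
    (∀ y w : complexBetti X 2, k3HilbertForm 2 (φ (θ y)) (φ w) = k3HilbertForm 2 (φ y) (φ (θ w))) ∧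
    ∃ ev : ℂ, θ (LinearEquiv.symm φ z) = ev • LinearEquiv.symm φ z ∧ ev.im = 0 ∧
      (minpoly ℚ ev).natDegree = d ∧
      (∃ n : ℕ, 3 ≤ n ∧ d * n + Module.finrank ℂ ↥(algebraicClasses X 1) = 23) ∧
      ∀ f : complexBetti X 2 →ₗ[ℂ] complexBetti X 2, (∀ y, IsRationalClass y → IsRationalClass (f y)) →
        (∀ (i j : ℕ) y, IsOfHodgeType 4 X 2 i j y → IsOfHodgeType 4 X 2 i j (f y)) →
        ∃ c : Fin d → ℚ, ∀ y : complexBetti X 2,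
          (∀ a : complexBetti X 2, a ∈ algebraicClasses X 1 → k3HilbertForm 2 (φ y) (φ a) = 0) →
            f y = ∑ i : Fin d, ((c i : ℂ) • (θ ^ (i : ℕ)) y))

/-- `Kap[φ, g] = Σ_{ij} (G⁻¹)_{ij} · φ⁻¹eᵢ ∪ g(φ⁻¹eⱼ) ∈ H⁴(X(ℂ); ℂ)`, the kappa class of an endomorphism `g`
of `H²(X(ℂ); ℂ)` (VERBATIM `…K3Sq2TypeHodgeGraphClassesGeneral`). Local notation only. -/
local notation3 (prettyPrint := false) "Kap[" φ ", " g "]" =>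
  (∑ i : K3HilbertIndex, ∑ j : K3HilbertIndex,
    (((k3HilbertGram 2).map (Int.cast : ℤ → ℂ))⁻¹ i j) •
      cupProduct (rfl : 2 + 2 = 2 * 2) ((LinearEquiv.symm φ) (Pi.single i 1))
        (g ((LinearEquiv.symm φ) (Pi.single j 1))))

/-- `CellHC[ρ, d]`: **HC⁴ on the cell `(ρ(X), [E:ℚ]) = (ρ, d)`** — for every marked smooth projective `K3^{[2]}`-type
`(X, φ, P, z)` with `¬ SpannedByIsometries`, `ρ(X) = ρ` and `RMgen[X, φ, z, d]` (the `InCell`/`CellHC` of Sketch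
P1AK-CELLS, curried), `HodgeConjectureFor 4 X`. Local notation only. -/
local notation3 (prettyPrint := false) "CellHC[" ρ ", " d "]" =>
  (∀ (X : SchemeOver ℂ), IsSmoothProjective 4 X → IsOfK3HilbertSquareType X →
    ∀ (φ : complexBetti X 2 ≃ₗ[ℂ] (K3HilbertIndex → ℂ)) (P : complexBetti X (2 * 4)) (z : K3HilbertIndex → ℂ),
      MarkedK3Sq[X, φ, P, z] → ¬ SpIso[X, φ] → Module.finrank ℂ ↥(algebraicClasses X 1) = ρ →
        RMgen[X, φ, z, d] → HodgeConjectureFor 4 X)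

/-- `CellKappaPowLt[ρ, d]`: **the `d − 1` kappa classes `κ_{θᵏ}`, `1 ≤ k < d`, are algebraic on the cell `(ρ, d)`**
— for every marked smooth projective `K3^{[2]}`-type `(X, φ, P, z)` with `¬ SpannedByIsometries`, `ρ(X) = ρ`, and every
`θ` carrying the data of `RMgen[X, φ, z, d]`. Local notation only. -/
local notation3 (prettyPrint := false) "CellKappaPowLt[" ρ ", " d "]" =>
  (∀ (X : SchemeOver ℂ), IsSmoothProjective 4 X → IsOfK3HilbertSquareType X →
    ∀ (φ : complexBetti X 2 ≃ₗ[ℂ] (K3HilbertIndex → ℂ)) (P : complexBetti X (2 * 4)) (z : K3HilbertIndex → ℂ),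
      MarkedK3Sq[X, φ, P, z] → ¬ SpIso[X, φ] → Module.finrank ℂ ↥(algebraicClasses X 1) = ρ →
        ∀ θ : complexBetti X 2 →ₗ[ℂ] complexBetti X 2, (∀ y, IsRationalClass y → IsRationalClass (θ y)) →
          (∀ (i j : ℕ) y, IsOfHodgeType 4 X 2 i j y → IsOfHodgeType 4 X 2 i j (θ y)) →
          (∀ y w : complexBetti X 2, k3HilbertForm 2 (φ (θ y)) (φ w) = k3HilbertForm 2 (φ y) (φ (θ w))) →
          (∃ ev : ℂ, θ (LinearEquiv.symm φ z) = ev • LinearEquiv.symm φ z ∧ ev.im = 0 ∧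
            (minpoly ℚ ev).natDegree = d ∧
            (∃ n : ℕ, 3 ≤ n ∧ d * n + Module.finrank ℂ ↥(algebraicClasses X 1) = 23) ∧
            ∀ f : complexBetti X 2 →ₗ[ℂ] complexBetti X 2, (∀ y, IsRationalClass y → IsRationalClass (f y)) →
              (∀ (i j : ℕ) y, IsOfHodgeType 4 X 2 i j y → IsOfHodgeType 4 X 2 i j (f y)) →
              ∃ c : Fin d → ℚ, ∀ y : complexBetti X 2,
                (∀ a : complexBetti X 2, a ∈ algebraicClasses X 1 → k3HilbertForm 2 (φ y) (φ a) = 0) →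
                  f y = ∑ i : Fin d, ((c i : ℂ) • (θ ^ (i : ℕ)) y)) →
          ∀ k : ℕ, 1 ≤ k → k < d → Kap[φ, θ ^ k] ∈ algebraicClasses X 2)

/-! ### The table, for every cell -/

/-- **`CellHC[ρ, d] → CellKappaPowLt[ρ, d]`** (fact-free): if HC⁴ holds on the cell, the kappa classes of all powers
of `θ` are algebraic (`cellKappaPow_of_cellHC`), in particular the `d − 1` ones. [cite: Markman2024, §1.1 Thm. 1.1]
[cite: OGrady2008NumericalK3Square, §2.2] -/
theorem cellKappaPowLt_of_cellHC {ρ d : ℕ} (h : CellHC[ρ, d]) : CellKappaPowLt[ρ, d] := by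
  intro X hX hK φ P z hM hsp hρ θ h1 h2 h5 hdata k _ _
  exact cellKappaPow_of_cellHC h X hX hK φ P z hM hsp hρ θ h1 h2 h5 hdata k

/-- **`CellKappaPowLt[ρ, d] → CellHC[ρ, d]`** (Charles–Markman-free): the `d − 1` classes algebraic on the cell ⟹ HC⁴
on the cell, by «KAPPA-IFF-SHARP» with the GEN clause of `RMgen`. Modulo {Verbitsky–Guan, O'Grady 2008}.
[cite: Novario2026HodgeClassesHilbertSquares, Thm. 6.2 and §4] [cite: OGrady2008NumericalK3Square, §3] -/
theorem cellHC_of_cellKappaPowLt {ρ d : ℕ} (hV : VerbitskyGuan_cohomology_K3HilbertSquareType)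
    (hO : OGrady2008_dualBBFClass_algebraic) (h : CellKappaPowLt[ρ, d]) : CellHC[ρ, d] := by
  intro X hX hK φ P z hM hsp hρ hgen
  obtain ⟨θ, h1, h2, h5, hdata⟩ := hgen
  obtain ⟨ev, hev, hevim, hdeg, hn, hG⟩ := id hdata
  exact hodgeConjectureFor_of_kappaClass_pow_lt_mem_algebraicClasses hV hO hX hK hM θ h1 h2 h5 hG
    (h X hX hK φ P z hM hsp hρ θ h1 h2 h5 hdata)

/-- **«KAPPA TABLE»: `CellHC[ρ, d] ↔ CellKappaPowLt[ρ, d]` for EVERY `(ρ, d)`** — HC⁴ on a cell of crux #5 is EXACTLY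
the algebraicity of the `d − 1` kappa classes `κ_θ, …, κ_{θ^{d−1}}` on that cell. Modulo {Verbitsky–Guan, O'Grady 2008}
(used by `←` only); no Charles–Markman. [cite: Novario2026HodgeClassesHilbertSquares, Thm. 6.2 and §4]
[cite: OGrady2008NumericalK3Square, §2.2 and §3] [cite: Markman2024, §1.1 Thm. 1.1] -/
theorem cellHC_iff_cellKappaPowLt (hV : VerbitskyGuan_cohomology_K3HilbertSquareType)
    (hO : OGrady2008_dualBBFClass_algebraic) (ρ d : ℕ) : CellHC[ρ, d] ↔ CellKappaPowLt[ρ, d] :=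
  ⟨cellKappaPowLt_of_cellHC, cellHC_of_cellKappaPowLt hV hO⟩

/-! ### The six cells of the crux, by name -/

/-- Cell `(1,2)` (orphan; `E(X)` real quadratic): HC⁴ ⟺ the ONE class `κ_θ` (cf. `cellHC_12_iff_cellKappa_12`).
[cite: OGrady2008NumericalK3Square, §3] [cite: Markman2024, §1.1 Thm. 1.1] -/
theorem cellHC_iff_cellKappaPowLt_12 (hV : VerbitskyGuan_cohomology_K3HilbertSquareType)
    (hO : OGrady2008_dualBBFClass_algebraic) : CellHC[1, 2] ↔ CellKappaPowLt[1, 2] :=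
  cellHC_iff_cellKappaPowLt hV hO 1 2

/-- Cell `(2,3)` (`E(X)` totally real cubic): HC⁴ ⟺ the TWO classes `κ_θ, κ_{θ²}`.
[cite: OGrady2008NumericalK3Square, §3] [cite: Markman2024, §1.1 Thm. 1.1] -/
theorem cellHC_iff_cellKappaPowLt_23 (hV : VerbitskyGuan_cohomology_K3HilbertSquareType)
    (hO : OGrady2008_dualBBFClass_algebraic) : CellHC[2, 3] ↔ CellKappaPowLt[2, 3] :=
  cellHC_iff_cellKappaPowLt hV hO 2 3

/-- Cell `(2,7)` (`E(X)` totally real septic): HC⁴ ⟺ the SIX classes `κ_θ, …, κ_{θ⁶}`.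
[cite: OGrady2008NumericalK3Square, §3] [cite: Markman2024, §1.1 Thm. 1.1] -/
theorem cellHC_iff_cellKappaPowLt_27 (hV : VerbitskyGuan_cohomology_K3HilbertSquareType)
    (hO : OGrady2008_dualBBFClass_algebraic) : CellHC[2, 7] ↔ CellKappaPowLt[2, 7] :=
  cellHC_iff_cellKappaPowLt hV hO 2 7

/-- Cell `(3,2)` (`E(X)` real quadratic, `ρ(X) = 3`): HC⁴ ⟺ the ONE class `κ_θ`.
[cite: OGrady2008NumericalK3Square, §3] [cite: Markman2024, §1.1 Thm. 1.1] -/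
theorem cellHC_iff_cellKappaPowLt_32 (hV : VerbitskyGuan_cohomology_K3HilbertSquareType)
    (hO : OGrady2008_dualBBFClass_algebraic) : CellHC[3, 2] ↔ CellKappaPowLt[3, 2] :=
  cellHC_iff_cellKappaPowLt hV hO 3 2

/-- Cell `(3,4)` (`E(X)` totally real quartic): HC⁴ ⟺ the THREE classes `κ_θ, κ_{θ²}, κ_{θ³}`.
[cite: OGrady2008NumericalK3Square, §3] [cite: Markman2024, §1.1 Thm. 1.1] -/
theorem cellHC_iff_cellKappaPowLt_34 (hV : VerbitskyGuan_cohomology_K3HilbertSquareType)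
    (hO : OGrady2008_dualBBFClass_algebraic) : CellHC[3, 4] ↔ CellKappaPowLt[3, 4] :=
  cellHC_iff_cellKappaPowLt hV hO 3 4

/-- Cell `(3,5)` (`E(X)` totally real quintic, e.g. `ℚ(ζ₁₁ + ζ₁₁⁻¹)`): HC⁴ ⟺ the FOUR classes `κ_θ, …, κ_{θ⁴}`.
[cite: OGrady2008NumericalK3Square, §3] [cite: GeemenSchutt2023, Thm. 1.1 (11)] -/
theorem cellHC_iff_cellKappaPowLt_35 (hV : VerbitskyGuan_cohomology_K3HilbertSquareType)
    (hO : OGrady2008_dualBBFClass_algebraic) : CellHC[3, 5] ↔ CellKappaPowLt[3, 5] :=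
  cellHC_iff_cellKappaPowLt hV hO 3 5

end Summit.HodgeConjecture.HodgeConjecture.Theorems.MarkmanPartnerTransport.PartnerLattice

end
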